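import Mathlib
import Summits.ValiantsHypothesis.ValiantsHypothesis.Theorems.LacunarySymmetroidMatrixDescartesInertiaIndexFormula

/-!
# `MatrixDescartes` (stmt-ValiantsHypothesis-18050) — INERTIA KIT, IV-g: MATRIX ROLLE ON DEFINITE-DERIVATIVE WINDOWS — between two
# scales where the DERIVATIVE PENCIL `F′(x) = ∑ₖ dₖx^{dₖ−1}Sₖ` stays definite, `det F` has EXACTLY `|ν(F(b)) − ν(F(a))| ≤ m` roots
# counted with multiplicity; definiteness of `F′` on `[a, b]` is certified by ONE definite scale plus `det F′ ≠ 0` on `[a, b]`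

HONEST FRAMING.  Cell `pub-symmetroid`, seat `val-sym-mdr-p2` (gen 17); helper file `--supports` the crux
`Theses.LacunarySymmetroid.MatrixDescartes`, NO closure claim.  General theorem for EVERY real symmetric lacunary pencil at EVERY
format: the matrix form of Rolle's «`f′ ≠ 0` on a window ⇒ at most one zero there» that DOES hold — on windows where the derivative
pencil is DEFINITE (the refuted `Theses.SymmetroidDescartes.DerivedPencilRolle`, tree `not_DerivedPencilRolle`, asked for a polynomial
Rolle budget on ALL windows).  A sufficient condition for the ONE-TYPE window law of `…InertiaIndexFormula`; nothing here bears on the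
crux in its window, on `stub_twoSided`, on `DoorA26`/`DoorA34`, registers, or `VP ≠ VNP`.

CONTENT.  §1 `negIndex_eq_card_of_negDef` / `negDef_of_negIndex_eq_card` (`ν(A) = m ⇔ A ≺ 0`, family language), §2 `derivPencil_eq`
(`F′(x)` is the lacunary pencil with exponents `dₖ − 1` and letters `dₖSₖ`), `derivPencil_negDef_of_certificate` (if `det F′ ≠ 0` on
`[a, b]` and `F′(c₀) ≺ 0` at one `c₀ ∈ [a, b]` then `F′ ≺ 0` on `[a, b]`: local constancy of `ν`, `Inertia.negIndex_eq_of_noRoot_Icc`),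
§3 MATRIX ROLLE `card_roots_Ioo_eq_of_derivNegDef` (`a < b` non-singular for `F`, `F′(x) ≺ 0` for all `x ∈ (a, b)` ⇒ every root in
`(a, b)` is of negative type ⇒ `#{roots in (a,b) with multiplicity} + ν(F(a)) = ν(F(b))`), `card_roots_Ioo_eq_of_derivPosDef` (mirror),
and the certificate forms `card_roots_Ioo_eq_of_derivCertificate_neg/pos`.  Consequence (reading, via `…InertiaTypeRuns`): the roots of
`det F′` cut `(0, ∞)` into windows of constant inertia of `F′`; on each DEFINITE window `det F` has at most `m` roots with multiplicity —
all excess lives in the windows where `F′` is indefinite. [folklore]; axioms standard; no definitions.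
-/

-- layout Summits/ValiantsHypothesis/ValiantsHypothesis forces the duplicated namespace component
set_option linter.dupNamespace false

namespace Summit.ValiantsHypothesis.ValiantsHypothesis.Theorems.LacunarySymmetroidMatrixDescartes

open Matrix Finset Polynomial
open scoped BigOperators Topology

namespace Inertia

variable {ι : Type} [Fintype ι] [DecidableEq ι]

/-! ## §1 Negative definite ⇔ full negative index -/

/-- A negative definite symmetric matrix has `ν = card ι`. [folklore] -/
theorem negIndex_eq_card_of_negDef {A : Matrix ι ι ℝ} (hA : A.IsHermitian) (hneg : ∀ u : ι → ℝ, u ≠ 0 → u ⬝ᵥ (A *ᵥ u) < 0) :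
    Fintype.card {j // hA.eigenvalues j < 0} = Fintype.card ι := by
  refine le_antisymm (Fintype.card_subtype_le _) ?_
  have h := card_le_negIndex hA (fun i : ι => (Pi.single i 1 : ι → ℝ)) fun c hc => by
    have hc' : (∑ i, c i • (Pi.single i 1 : ι → ℝ)) = c := by
      funext a
      simp [Finset.sum_apply, Pi.smul_apply, Pi.single_apply]
    rw [hc']
    exact hneg c hc
  exact h

/-- Expansion of a vector in the eigenvector basis. [folklore] -/
theorem eq_sum_eigenvectorBasis {A : Matrix ι ι ℝ} (hA : A.IsHermitian) (u : ι → ℝ) :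
    u = ∑ j, (hA.eigenvectorBasis.repr (WithLp.toLp 2 u) j) • (hA.eigenvectorBasis j).ofLp := by
  have h := hA.eigenvectorBasis.sum_repr (WithLp.toLp 2 u)
  have h2 := congrArg WithLp.ofLp h
  rw [WithLp.ofLp_sum] at h2
  simp only [WithLp.ofLp_smul] at h2
  exact h2.symm

/-- `ν = card ι` forces negative definiteness. [folklore] -/
theorem negDef_of_negIndex_eq_card {A : Matrix ι ι ℝ} (hA : A.IsHermitian)
    (hν : Fintype.card {j // hA.eigenvalues j < 0} = Fintype.card ι) (u : ι → ℝ) (hu : u ≠ 0) :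
    u ⬝ᵥ (A *ᵥ u) < 0 := by
  -- every eigenvalue is negative
  have hall : ∀ j, hA.eigenvalues j < 0 := by
    by_contra h
    push Not at h
    obtain ⟨j, hj⟩ := h
    have := Fintype.card_subtype_lt (p := fun j => hA.eigenvalues j < 0) (x := j) (not_lt.2 hj)
    omega
  set c : ι → ℝ := fun j => hA.eigenvectorBasis.repr (WithLp.toLp 2 u) j with hc
  have hu' : u = ∑ j, c j • (hA.eigenvectorBasis j).ofLp := eq_sum_eigenvectorBasis hA u
  have hc0 : c ≠ 0 := by
    intro h0
    apply hu
    rw [hu', h0]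
    simp
  obtain ⟨i, hi⟩ : ∃ i, c i ≠ 0 := by
    by_contra h; push Not at h; exact hc0 (funext h)
  rw [hu', form_eigenvectorBasis hA c]
  calc ∑ j, hA.eigenvalues j * c j ^ 2 < ∑ _j : ι, (0 : ℝ) :=
        Finset.sum_lt_sum (fun k _ => mul_nonpos_of_nonpos_of_nonneg (hall k).le (sq_nonneg _))
          ⟨i, Finset.mem_univ _, mul_neg_of_neg_of_pos (hall i) (by positivity)⟩
    _ = 0 := Finset.sum_const_zero

/-! ## §2 The derivative pencil -/

section Pencil

variable {κ : Type} [Fintype κ]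

omit [Fintype ι] [DecidableEq ι] in
/-- The derivative matrix `F′(x) = ∑ₖ dₖx^{dₖ−1}Sₖ` is the lacunary pencil with exponents `dₖ − 1` and letters `dₖ • Sₖ`. [folklore] -/
theorem derivPencil_eq (d : κ → ℕ) (S : κ → Matrix ι ι ℝ) (x : ℝ) :
    (∑ k, ((d k : ℝ) * x ^ (d k - 1)) • S k) = ∑ k, x ^ (d k - 1) • ((d k : ℝ) • S k) := by
  refine Finset.sum_congr rfl fun k _ => ?_
  rw [smul_smul, mul_comm]

/-- **Certificate for a negative-definite derivative window.**  If `det F′(x) ≠ 0` for every `x ∈ [a, b]` and `F′(c₀) ≺ 0` at ONE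
scale `c₀ ∈ [a, b]`, then `F′(x) ≺ 0` for every `x ∈ [a, b]`. [folklore] -/
theorem derivPencil_negDef_of_certificate (d : κ → ℕ) (S : κ → Matrix ι ι ℝ) (hS : ∀ k, (S k).IsSymm) {a b c₀ : ℝ}
    (hc₀ : c₀ ∈ Set.Icc a b) (hdet : ∀ x ∈ Set.Icc a b, (∑ k, ((d k : ℝ) * x ^ (d k - 1)) • S k).det ≠ 0)
    (hneg : ∀ u : ι → ℝ, u ≠ 0 → u ⬝ᵥ ((∑ k, ((d k : ℝ) * c₀ ^ (d k - 1)) • S k) *ᵥ u) < 0)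
    {x : ℝ} (hx : x ∈ Set.Icc a b) (u : ι → ℝ) (hu : u ≠ 0) :
    u ⬝ᵥ ((∑ k, ((d k : ℝ) * x ^ (d k - 1)) • S k) *ᵥ u) < 0 := by
  have hS' : ∀ k, ((d k : ℝ) • S k).IsSymm := fun k => (hS k).smul _
  set e : κ → ℕ := fun k => d k - 1 with he
  have hrew : ∀ y : ℝ, (∑ k, ((d k : ℝ) * y ^ (d k - 1)) • S k) = ∑ k, y ^ e k • ((d k : ℝ) • S k) :=
    fun y => derivPencil_eq d S y
  have hdet' : ∀ y ∈ Set.Icc a b, (∑ k, y ^ e k • ((d k : ℝ) • S k)).det ≠ 0 := fun y hy => by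
    rw [← hrew]; exact hdet y hy
  -- `ν(F′)` is constant on `[a, b]`, and equals `card ι` at `c₀`
  have hνc : Fintype.card {j // (isHermitian_pencil e _ hS' c₀).eigenvalues j < 0} = Fintype.card ι :=
    negIndex_eq_card_of_negDef _ fun v hv => by rw [← hrew]; exact hneg v hv
  have hνx : Fintype.card {j // (isHermitian_pencil e _ hS' x).eigenvalues j < 0} = Fintype.card ι := by
    rcases le_total c₀ x with hcx | hxc
    · rw [negIndex_eq_of_noRoot_Icc (fun y => ∑ k, y ^ e k • ((d k : ℝ) • S k)) (continuous_pencil_entry e _)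
        (isHermitian_pencil e _ hS') hcx (fun y hy => hdet' y ⟨le_trans hc₀.1 hy.1, le_trans hy.2 hx.2⟩)]
      exact hνc
    · rw [← negIndex_eq_of_noRoot_Icc (fun y => ∑ k, y ^ e k • ((d k : ℝ) • S k)) (continuous_pencil_entry e _)
        (isHermitian_pencil e _ hS') hxc (fun y hy => hdet' y ⟨le_trans hx.1 hy.1, le_trans hy.2 hc₀.2⟩)]
      exact hνc
  rw [hrew]
  exact negDef_of_negIndex_eq_card _ hνx u hu

/-! ## §3 Matrix Rolle on definite-derivative windows -/

/-- **MATRIX ROLLE, negative-definite derivative.**  `a < b` non-singular scales for `F`, and `F′(x) ≺ 0` for every `x ∈ (a, b)`.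
Then every root of `det F` in `(a, b)` is of negative type, so the roots in `(a, b)` counted with multiplicity number EXACTLY
`ν(F(b)) − ν(F(a)) ≤ m` (and `π(F(a)) − π(F(b))`). [folklore] -/
theorem card_roots_Ioo_eq_of_derivNegDef (d : κ → ℕ) (S : κ → Matrix ι ι ℝ) (hS : ∀ k, (S k).IsSymm)
    {a b : ℝ} (hab : a < b) (ha : (∑ k, a ^ d k • S k).det ≠ 0) (hb : (∑ k, b ^ d k • S k).det ≠ 0)
    (hderiv : ∀ x, a < x → x < b → ∀ u : ι → ℝ, u ≠ 0 → u ⬝ᵥ ((∑ k, ((d k : ℝ) * x ^ (d k - 1)) • S k) *ᵥ u) < 0) :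
    Multiset.card ((Matrix.det (∑ k, ((X : ℝ[X]) ^ d k) • (S k).map C)).roots.filter (fun t => a < t ∧ t < b))
        + Fintype.card {j // (isHermitian_pencil d S hS a).eigenvalues j < 0}
      = Fintype.card {j // (isHermitian_pencil d S hS b).eigenvalues j < 0} ∧
    Multiset.card ((Matrix.det (∑ k, ((X : ℝ[X]) ^ d k) • (S k).map C)).roots.filter (fun t => a < t ∧ t < b))
        + Fintype.card {j // 0 < (isHermitian_pencil d S hS b).eigenvalues j}
      = Fintype.card {j // 0 < (isHermitian_pencil d S hS a).eigenvalues j} :=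
  card_roots_Ioo_add_negIndex_eq_of_negType d S hS hab ha hb fun t h1 h2 _ u _ hu0 => by
    rw [← Multiplicity.form_derivative_eq_eval]
    exact hderiv t h1 h2 u hu0

/-- **MATRIX ROLLE, positive-definite derivative**: `F′(x) ≻ 0` on `(a, b)` ⇒ the roots in `(a, b)` counted with multiplicity number
exactly `ν(F(a)) − ν(F(b)) = π(F(b)) − π(F(a))`. [folklore] -/
theorem card_roots_Ioo_eq_of_derivPosDef (d : κ → ℕ) (S : κ → Matrix ι ι ℝ) (hS : ∀ k, (S k).IsSymm)
    {a b : ℝ} (hab : a < b) (ha : (∑ k, a ^ d k • S k).det ≠ 0) (hb : (∑ k, b ^ d k • S k).det ≠ 0)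
    (hderiv : ∀ x, a < x → x < b → ∀ u : ι → ℝ, u ≠ 0 → 0 < u ⬝ᵥ ((∑ k, ((d k : ℝ) * x ^ (d k - 1)) • S k) *ᵥ u)) :
    Multiset.card ((Matrix.det (∑ k, ((X : ℝ[X]) ^ d k) • (S k).map C)).roots.filter (fun t => a < t ∧ t < b))
        + Fintype.card {j // (isHermitian_pencil d S hS b).eigenvalues j < 0}
      = Fintype.card {j // (isHermitian_pencil d S hS a).eigenvalues j < 0} ∧
    Multiset.card ((Matrix.det (∑ k, ((X : ℝ[X]) ^ d k) • (S k).map C)).roots.filter (fun t => a < t ∧ t < b))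
        + Fintype.card {j // 0 < (isHermitian_pencil d S hS a).eigenvalues j}
      = Fintype.card {j // 0 < (isHermitian_pencil d S hS b).eigenvalues j} :=
  card_roots_Ioo_add_negIndex_eq_of_posType d S hS hab ha hb fun t h1 h2 _ u _ hu0 => by
    rw [← Multiplicity.form_derivative_eq_eval]
    exact hderiv t h1 h2 u hu0

/-- **MATRIX ROLLE, certificate form (negative).**  `a < b` non-singular for `F`; `det F′ ≠ 0` on `[a, b]` and `F′(c₀) ≺ 0` at one
`c₀ ∈ [a, b]`.  Then the roots of `det F` in `(a, b)` counted with multiplicity number exactly `ν(F(b)) − ν(F(a)) ≤ m`. [folklore] -/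
theorem card_roots_Ioo_eq_of_derivCertificate_neg (d : κ → ℕ) (S : κ → Matrix ι ι ℝ) (hS : ∀ k, (S k).IsSymm)
    {a b c₀ : ℝ} (hab : a < b) (ha : (∑ k, a ^ d k • S k).det ≠ 0) (hb : (∑ k, b ^ d k • S k).det ≠ 0)
    (hc₀ : c₀ ∈ Set.Icc a b) (hdet : ∀ x ∈ Set.Icc a b, (∑ k, ((d k : ℝ) * x ^ (d k - 1)) • S k).det ≠ 0)
    (hneg : ∀ u : ι → ℝ, u ≠ 0 → u ⬝ᵥ ((∑ k, ((d k : ℝ) * c₀ ^ (d k - 1)) • S k) *ᵥ u) < 0) :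
    Multiset.card ((Matrix.det (∑ k, ((X : ℝ[X]) ^ d k) • (S k).map C)).roots.filter (fun t => a < t ∧ t < b))
        + Fintype.card {j // (isHermitian_pencil d S hS a).eigenvalues j < 0}
      = Fintype.card {j // (isHermitian_pencil d S hS b).eigenvalues j < 0} :=
  (card_roots_Ioo_eq_of_derivNegDef d S hS hab ha hb fun _ h1 h2 u hu =>
    derivPencil_negDef_of_certificate d S hS hc₀ hdet hneg ⟨h1.le, h2.le⟩ u hu).1

/-- **MATRIX ROLLE, certificate form (positive).**  `det F′ ≠ 0` on `[a, b]` and `F′(c₀) ≻ 0` at one `c₀ ∈ [a, b]` ⇒ the roots of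
`det F` in `(a, b)` counted with multiplicity number exactly `ν(F(a)) − ν(F(b)) ≤ m`. [folklore] -/
theorem card_roots_Ioo_eq_of_derivCertificate_pos (d : κ → ℕ) (S : κ → Matrix ι ι ℝ) (hS : ∀ k, (S k).IsSymm)
    {a b c₀ : ℝ} (hab : a < b) (ha : (∑ k, a ^ d k • S k).det ≠ 0) (hb : (∑ k, b ^ d k • S k).det ≠ 0)
    (hc₀ : c₀ ∈ Set.Icc a b) (hdet : ∀ x ∈ Set.Icc a b, (∑ k, ((d k : ℝ) * x ^ (d k - 1)) • S k).det ≠ 0)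
    (hpos : ∀ u : ι → ℝ, u ≠ 0 → 0 < u ⬝ᵥ ((∑ k, ((d k : ℝ) * c₀ ^ (d k - 1)) • S k) *ᵥ u)) :
    Multiset.card ((Matrix.det (∑ k, ((X : ℝ[X]) ^ d k) • (S k).map C)).roots.filter (fun t => a < t ∧ t < b))
        + Fintype.card {j // (isHermitian_pencil d S hS b).eigenvalues j < 0}
      = Fintype.card {j // (isHermitian_pencil d S hS a).eigenvalues j < 0} := by
  -- apply the negative certificate to the letters `−Sₖ` (same determinant roots up to sign, `F′ ↦ −F′`)
  refine (card_roots_Ioo_eq_of_derivPosDef d S hS hab ha hb fun y h1 h2 u hu => ?_).1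
  have hS' : ∀ k, (-S k).IsSymm := fun k => (hS k).neg
  have hrew : ∀ y : ℝ, (∑ k, ((d k : ℝ) * y ^ (d k - 1)) • (-S k)) = -∑ k, ((d k : ℝ) * y ^ (d k - 1)) • S k := by
    intro y
    rw [← Finset.sum_neg_distrib]
    exact Finset.sum_congr rfl fun k _ => by rw [smul_neg]
  have h := derivPencil_negDef_of_certificate d (fun k => -S k) hS' hc₀
    (fun y hy => by
      rw [hrew, Matrix.det_neg, mul_ne_zero_iff]
      exact ⟨pow_ne_zero _ (by norm_num), hdet y hy⟩)
    (fun v hv => by rw [hrew, Matrix.neg_mulVec, dotProduct_neg, neg_lt_zero]; exact hpos v hv)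
    (x := y) ⟨h1.le, h2.le⟩ u hu
  rw [hrew, Matrix.neg_mulVec, dotProduct_neg, neg_lt_zero] at h
  exact h

end Pencil

end Inertia

end Summit.ValiantsHypothesis.ValiantsHypothesis.Theorems.LacunarySymmetroidMatrixDescartes
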